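import Summits.QuantumFields.YangMills.Theorems.FlatTubeReductionDecimationGaugeStep
import Summits.QuantumFields.YangMills.Theorems.FlatTubeReductionDecimationFrame
import HarnessLib

/-!
# Route `FlatTubeReduction`, crux `PinnedUnitStepEx` (stmt-QuantumFields-27561), stub `stub_smearVarPosGS1` — E2c: moving the merge position by a
# one-site gauge transformation

Seat ym-line-fcl-p3 g9 (2026-08-28).  Blueprint v2 §Simplification, made concrete.  The READING of the coarse torus through decoder `v` translated by
`m̄` is `W_{m̄,v}(U)(x,i) = thin L' (τ_v U)(x − m̄, i)`.  One unit step of a trivial decoder in direction `j` replaces `(m̄, v)` by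
`(m̄ + e_j, v − e_j)`; the two readings differ exactly on the `j`-links across the coarse slice `m̄_j + 1` («merge at the next position»), and
★ `reading_step_gauge`: on every link of a set `R` having no transverse link in that slice, the old reading is the ONE-SITE-PER-LINE gauge transform
`k_U(z) = U(second fine link)⁻¹` (`z_j = m̄_j + 1`) of the new one.  Hence ★★ `esPart_reading_step`: `g^{=R}(W_{m̄,v} U) = g^{=R}(W_{m̄+e_j, v−e_j} U)`
for gauge-invariant `g` (`esPart_eq_of_gauge_eqOn`) — all same-run decoder terms of the fine identity (★) coincide.  Requires `2 ≤ L'`.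
R2b1 RECORD rung; no summit/crux/stub here.
-/

set_option autoImplicit false

noncomputable section

namespace Summit.QuantumFields.YangMills.Theorems.FlatTubeReduction.Decimation

open MeasureTheory Finset Function
open Literature.MathematicalPhysics.QuantumFieldTheory (Site Edge GaugeConfig gaugeTransform haarProbability)
open Literature.MathematicalPhysics.QuantumFieldTheory.TorusTranslation
open Summit.QuantumFields.YangMills.Theorems.FemtoCutoffLadder.Thinning
open Literature.Probability.Independence.Hoeffding

variable {G : Type*} [Group G] [MeasurableSpace G] {L' : ℕ} [NeZero L']

omit [NeZero L'] in
/-- The reading through decoder `v` translated by `m̄`, unfolded: one fine link, or two when `(x − m̄)_i = 0`. [folklore] -/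
theorem reading_apply (mbar : Site 3 L') (v : Site 3 (L' + 1)) (U : GaugeConfig 3 (L' + 1) G) (x : Site 3 L') (i : Fin 3) :
    thin L' (torusConfigShift v U) (x - mbar, i) =
      if (x - mbar) i = 0 then U (thinSite (L' + 1) (x - mbar) - v, i) * U (thinSite (L' + 1) (x - mbar) + Pi.single i 1 - v, i)
      else U (thinSite (L' + 1) (x - mbar) - v, i) := by
  rw [thin_shift_apply]
  have : ((x - mbar) i).val < L' + 1 - L' ↔ (x - mbar) i = 0 := by rw [Nat.add_sub_cancel_left, Nat.lt_one_iff, ZMod.val_eq_zero]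
  by_cases h : (x - mbar) i = 0
  · rw [if_pos (this.2 h), if_pos h]
  · rw [if_neg (mt this.1 h), if_neg h]

/-- Base points of the stepped reading: off the coordinate `j` they agree; in the coordinate `j`, `ι(a−1) + 1 = ι a` unless `a = 1`. [folklore] -/
theorem thinSite_step_eq (mbar : Site 3 L') (v : Site 3 (L' + 1)) (x : Site 3 L') (j : Fin 3) (h1 : (x - mbar) j ≠ 1) :
    thinSite (L' + 1) (x - (mbar + Pi.single j 1)) - (v - Pi.single j 1) = thinSite (L' + 1) (x - mbar) - v := by
  funext k
  simp only [Pi.sub_apply, Pi.add_apply, thinSite, Pi.single_apply]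
  by_cases hk : k = j
  · subst hk
    simp only [if_true]
    -- `ι(a − 1) + 1 = ι a` for `a − 1 ≠ 0`
    set a := x k - mbar k with ha
    have hne : a - 1 ≠ 0 := fun h => h1 (by rw [sub_eq_zero] at h; exact h)
    have := thinCoord_succ_add_one (L' := L') (a - 1)
    rw [sub_add_cancel, if_neg hne] at this
    rw [show x k - (mbar k + 1) = a - 1 by rw [ha]; ring, this]
    ring
  · simp only [if_neg hk, add_zero, sub_zero]

/-- ★ **The stepped reading is a one-site gauge transform of the old one on transverse-free slices.**  Let `R` have no link of direction `≠ j` based in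
the coarse slice `x_j = m̄_j + 1`.  With `k_U(z) = U(thinSite(z − m̄ − e_j) − v + e_j, j)⁻¹` for `z_j = m̄_j + 1` and `1` otherwise, for every
`(x,i) ∈ R`: `W_{m̄,v}(U)(x,i) = (k_U • W_{m̄+e_j, v−e_j}(U))(x,i)`. [folklore] -/
theorem reading_step_gauge (hL : 2 ≤ L') (R : Finset (Edge 3 L')) (j : Fin 3) (mbar : Site 3 L') (v : Site 3 (L' + 1))
    (hslice : ∀ e ∈ R, e.1 j = mbar j + 1 → e.2 = j) (U : GaugeConfig 3 (L' + 1) G) (e : Edge 3 L') (he : e ∈ R) :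
    thin L' (torusConfigShift v U) (e.1 - mbar, e.2) =
      gaugeTransform (fun z : Site 3 L' => if z j = mbar j + 1 then
          (U (thinSite (L' + 1) (z - (mbar + Pi.single j 1)) - (v - Pi.single j 1), j))⁻¹ else 1)
        (fun e' : Edge 3 L' => thin L' (torusConfigShift (v - Pi.single j 1) U) (e'.1 - (mbar + Pi.single j 1), e'.2)) e := by
  obtain ⟨x, i⟩ := e
  simp only [gaugeTransform, Literature.MathematicalPhysics.QuantumFieldTheory.Site.shift]
  have hL1 : (1 : ZMod L') ≠ 0 := by
    haveI : Fact (1 < L') := ⟨by omega⟩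
    exact one_ne_zero
  set a : ZMod L' := x j - mbar j with ha
  by_cases hij : i = j
  · subst hij
    -- the three positions relative to the gauged slice
    by_cases ha0 : a = 0
    · -- `a = 0`: old reading doubled, new single; gauge factor at the END point
      have hx : x i = mbar i := by rw [← sub_eq_zero]; exact ha0
      have hk1 : ¬ (x i = mbar i + 1) := by rw [hx]; intro h; exact hL1 (by linear_combination -h)
      have hk2 : (x + Pi.single i (1 : ZMod L') : Site 3 L') i = mbar i + 1 := by simp [hx]
      rw [if_neg hk1, if_pos hk2, one_mul, inv_inv, reading_apply, reading_apply]
      have h0 : (x - mbar) i = 0 := by simpa using ha0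
      have h1' : ((x - (mbar + Pi.single i (1 : ZMod L')) : Site 3 L') i) ≠ 0 := by
        simp only [Pi.sub_apply, Pi.add_apply, Pi.single_eq_same, hx]
        intro h; exact hL1 (by linear_combination -h)
      have hne1 : (x - mbar) i ≠ 1 := by rw [h0]; exact hL1.symm
      rw [if_pos h0, if_neg h1', thinSite_step_eq mbar v x i hne1]
      congr 2
      -- the gauge factor's link is the second fine link of the doubled pair
      refine Prod.ext ?_ rfl
      funext k
      simp only [Pi.sub_apply, Pi.add_apply, thinSite, Pi.single_apply]
      by_cases hk : k = i
      · subst hk; simp only [if_true, add_sub_add_right_eq_sub]; ring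
      · simp [hk]
    · by_cases ha1 : a = 1
      · -- `a = 1`: old single, new doubled; gauge factor at the START point
        have hx : x i = mbar i + 1 := by rw [← sub_eq_iff_eq_add'] ; exact ha1
        have hk2 : ¬ ((x + Pi.single i (1 : ZMod L') : Site 3 L') i = mbar i + 1) := by
          simp only [Pi.add_apply, Pi.single_eq_same, hx]
          intro h; exact hL1 (by linear_combination h)
        rw [if_pos hx, if_neg hk2, inv_one, mul_one, reading_apply, reading_apply]
        have h0 : (x - mbar) i ≠ 0 := by simpa [ha] using ha0
        have h1' : ((x - (mbar + Pi.single i (1 : ZMod L')) : Site 3 L') i) = 0 := by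
          simp only [Pi.sub_apply, Pi.add_apply, Pi.single_eq_same, hx]; ring
        rw [if_neg h0, if_pos h1', ← mul_assoc, inv_mul_cancel, one_mul]
        -- `B₁ + e_i = B₀`
        congr 2
        funext k
        simp only [Pi.sub_apply, Pi.add_apply, thinSite, Pi.single_apply]
        by_cases hk : k = i
        · subst hk
          simp only [if_true, hx]
          rw [show mbar k + 1 - (mbar k + 1) = (0 : ZMod L') by ring, show mbar k + 1 - mbar k = (0 : ZMod L') + 1 by ring,
            thinCoord_succ_add_one, if_pos rfl]
          ring
        · simp only [if_neg hk, add_zero, sub_zero]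
      · -- generic position: both single, same base point, no gauge factor
        have hk1 : ¬ (x i = mbar i + 1) := fun h => ha1 (by rw [ha, h]; ring)
        have hk2 : ¬ ((x + Pi.single i (1 : ZMod L') : Site 3 L') i = mbar i + 1) := by
          simp only [Pi.add_apply, Pi.single_eq_same]
          intro h; exact ha0 (by rw [ha]; linear_combination h)
        rw [if_neg hk1, if_neg hk2, inv_one, mul_one, one_mul, reading_apply, reading_apply]
        have h0 : (x - mbar) i ≠ 0 := by simpa [ha] using ha0
        have h1' : ((x - (mbar + Pi.single i (1 : ZMod L')) : Site 3 L') i) ≠ 0 := by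
          simp only [Pi.sub_apply, Pi.add_apply, Pi.single_eq_same]
          intro h; exact ha1 (by rw [ha]; linear_combination h)
        have hne1 : (x - mbar) i ≠ 1 := by simpa [ha] using ha1
        rw [if_neg h0, if_neg h1', thinSite_step_eq mbar v x i hne1]
  · -- transverse link: not based in the gauged slice, endpoints ungauged, readings literally equal
    have hxj : x j ≠ mbar j + 1 := fun h => hij (hslice (x, i) he h)
    have hxj' : (x + Pi.single i (1 : ZMod L') : Site 3 L') j ≠ mbar j + 1 := by
      simp only [Pi.add_apply, Pi.single_apply, if_neg (Ne.symm hij) , add_zero]; exact hxj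
    rw [if_neg hxj, if_neg hxj', inv_one, mul_one, one_mul, reading_apply, reading_apply]
    have hne1 : (x - mbar) j ≠ 1 := by
      simp only [Pi.sub_apply]; intro h; exact hxj (by linear_combination h)
    have hdi : ((x - (mbar + Pi.single j (1 : ZMod L')) : Site 3 L') i) = (x - mbar) i := by
      simp [Pi.sub_apply, Pi.add_apply, hij]
    rw [hdi, thinSite_step_eq mbar v x j hne1]
    -- the second fine link of a doubled transverse path also has the same base (coordinate `j` untouched by `+ e_i`)
    by_cases h0 : (x - mbar) i = 0
    · rw [if_pos h0, if_pos h0]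
      congr 2
      rw [add_sub_right_comm, add_sub_right_comm (thinSite (L' + 1) (x - (mbar + Pi.single j 1))), thinSite_step_eq mbar v x j hne1]
    · rw [if_neg h0, if_neg h0]

variable [TopologicalSpace G] [IsTopologicalGroup G] [CompactSpace G] [BorelSpace G]

/-- ★★ **Same-run decoder terms coincide**: for gauge-invariant bounded measurable `g` and a set `R` with no transverse link in the coarse slice
`x_j = m̄_j + 1`, `g^{=R}(W_{m̄,v} U) = g^{=R}(W_{m̄+e_j, v−e_j} U)` for every `U`. [folklore] -/
theorem esPart_reading_step (hL : 2 ≤ L') {g : GaugeConfig 3 L' G → ℝ} (hg : Measurable g)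
    (hGI : ∀ (k : Site 3 L' → G) (W : GaugeConfig 3 L' G), g (gaugeTransform k W) = g W)
    (R : Finset (Edge 3 L')) (j : Fin 3) (mbar : Site 3 L') (v : Site 3 (L' + 1))
    (hslice : ∀ e ∈ R, e.1 j = mbar j + 1 → e.2 = j) (U : GaugeConfig 3 (L' + 1) G) :
    esPart (haarProbability G) R g (fun e : Edge 3 L' => thin L' (torusConfigShift v U) (e.1 - mbar, e.2)) =
      esPart (haarProbability G) R g
        (fun e : Edge 3 L' => thin L' (torusConfigShift (v - Pi.single j 1) U) (e.1 - (mbar + Pi.single j 1), e.2)) :=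
  esPart_eq_of_gauge_eqOn hg hGI R _ fun e he => reading_step_gauge hL R j mbar v hslice U e he

end Summit.QuantumFields.YangMills.Theorems.FlatTubeReduction.Decimation
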